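import Mathlib
import Summits.PneNP.PneNP.Theorems.OverlapGapAlgebraSolvableImpliesStableSectionUnitClauseDynamics

/-!
# PneNP / OverlapGapAlgebra — crux `SolvableImpliesStableSection` (stmt-PneNP-2463):
# the UNIT CLAUSE block (5/·) — classification of the violated clauses

Support for crux `stmt-PneNP-2463` (`Summit.PneNP.PneNP.Theses.OverlapGapAlgebra.SolvableImpliesStableSection`),
registered stub `stub_lowDensity` (child G).  After the `R` rounds of the localized unit-clause dynamics
(`…UnitClauseObjects`, no clause muted) every variable is set; a clause all of whose literals are then
false is of one of three kinds, according to the round `t₀` in which its last unset slots were set: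
(A) CONTRADICTION — exactly one slot was unset at round `t₀`; then the clause was unit, its variable
was forced, and since the clause ends violated the forcing (least) unit clause was ANOTHER clause unit
on the same variable in the same round; (B) COLLISION — two slots holding distinct variables were both
set during round `t₀`; (C) DEGENERATE — two slots hold the same variable.  The mean-violation bound of
the block counts the three kinds separately (pair/triple muting).

* `sissU_violated_classify` — a violated clause is of kind (A), (B) or (C).
All objects are hypotheses; no definitions; axioms `propext`, `Classical.choice`, `Quot.sound`.
-/

set_option linter.dupNamespace false -- `Summit.PneNP.PneNP.…`: summit = sub-problem (D-0017)

namespace Summit.PneNP.PneNP.Theorems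

open Finset
open scoped Classical

section Classify

variable {m k n : ℕ} {R : ℕ}

/-- **Classification of the violated clauses.** In the unit-clause dynamics with no muted clause and
`R ≥ 1` rounds (`k ≥ 1`), if every literal of clause `i` is false at round `R`, then either
(A) in some round `t < R` the clause `i` and another clause `i'` are both unit on the same variable, or
(B) in some round `t < R` two slots of `i` holding distinct variables are both unset at round `t` and set
at round `t + 1`, or (C) two distinct slots of `i` hold the same variable. -/
theorem sissU_violated_classify
    (st : Finset (Fin m) → ℕ → (Fin m → Fin k → Fin n × Bool) → Fin n → Option Bool)
    (dm : Finset (Fin m) → ℕ → (Fin m → Fin k → Fin n × Bool) → Fin n → Bool)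
    (h0 : ∀ (S : Finset (Fin m)) (Φ : Fin m → Fin k → Fin n × Bool) (v : Fin n), st S 0 Φ v = none)
    (hstep : ∀ (S : Finset (Fin m)) (t : ℕ) (Φ : Fin m → Fin k → Fin n × Bool) (v : Fin n),
      st S (t + 1) Φ v =
        if st S t Φ v = none then
          (if ∃ i : Fin m, i ∉ S ∧ ∃ j : Fin k, (Φ i j).1 = v ∧ ∀ j' : Fin k, j' ≠ j →
              st S t Φ (Φ i j').1 ≠ none ∧ st S t Φ (Φ i j').1 ≠ some (Φ i j').2
            then some (dm S t Φ v)
            else if (v : ℕ) * R / n = t then some true else none)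
        else st S t Φ v)
    (hdm : ∀ (S : Finset (Fin m)) (t : ℕ) (Φ : Fin m → Fin k → Fin n × Bool) (v : Fin n) (i : Fin m)
      (j : Fin k), i ∉ S → (Φ i j).1 = v → st S t Φ v = none →
      (∀ j' : Fin k, j' ≠ j → st S t Φ (Φ i j').1 ≠ none ∧ st S t Φ (Φ i j').1 ≠ some (Φ i j').2) →
      (∀ i' : Fin m, i' ∉ S → (∃ j₁ : Fin k, (Φ i' j₁).1 = v ∧ ∀ j' : Fin k, j' ≠ j₁ →
        st S t Φ (Φ i' j').1 ≠ none ∧ st S t Φ (Φ i' j').1 ≠ some (Φ i' j').2) → i ≤ i') →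
      dm S t Φ v = (Φ i j).2)
    (hk : 1 ≤ k) (hR : 1 ≤ R) (Φ : Fin m → Fin k → Fin n × Bool) (i : Fin m)
    (hviol : ∀ j : Fin k, st ∅ R Φ (Φ i j).1 ≠ some (Φ i j).2) :
    (∃ t : ℕ, t < R ∧ ∃ v : Fin n, ∃ i' : Fin m, i' ≠ i ∧
      (∃ j : Fin k, (Φ i j).1 = v ∧ st ∅ t Φ v = none ∧ ∀ j' : Fin k, j' ≠ j →
        st ∅ t Φ (Φ i j').1 ≠ none ∧ st ∅ t Φ (Φ i j').1 ≠ some (Φ i j').2) ∧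
      (∃ j : Fin k, (Φ i' j).1 = v ∧ st ∅ t Φ v = none ∧ ∀ j' : Fin k, j' ≠ j →
        st ∅ t Φ (Φ i' j').1 ≠ none ∧ st ∅ t Φ (Φ i' j').1 ≠ some (Φ i' j').2)) ∨
    (∃ t : ℕ, t < R ∧ ∃ j j' : Fin k, (Φ i j).1 ≠ (Φ i j').1 ∧
      st ∅ t Φ (Φ i j).1 = none ∧ st ∅ t Φ (Φ i j').1 = none ∧
      st ∅ (t + 1) Φ (Φ i j).1 ≠ none ∧ st ∅ (t + 1) Φ (Φ i j').1 ≠ none) ∨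
    (∃ j j' : Fin k, j ≠ j' ∧ (Φ i j).1 = (Φ i j').1) := by
  -- the first round index at which all slots of `i` are set is a successor `t₀ + 1 ≤ R`
  have hPR : ∃ t : ℕ, ∀ j : Fin k, st ∅ t Φ (Φ i j).1 ≠ none :=
    ⟨R, fun j => sissU_st_R_ne_none st dm hstep hR ∅ Φ _ R le_rfl⟩
  set t₁ := Nat.find hPR with ht₁
  have ht₁spec : ∀ j : Fin k, st ∅ t₁ Φ (Φ i j).1 ≠ none := Nat.find_spec hPR
  have ht₁R : t₁ ≤ R := Nat.find_min' hPR fun j => sissU_st_R_ne_none st dm hstep hR ∅ Φ _ R le_rfl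
  have ht₁0 : t₁ ≠ 0 := by
    intro h
    have := ht₁spec ⟨0, hk⟩
    rw [h] at this
    exact this (h0 ∅ Φ _)
  obtain ⟨t₀, ht₀⟩ : ∃ t₀ : ℕ, t₁ = t₀ + 1 := ⟨t₁ - 1, by omega⟩
  have ht₀R : t₀ < R := by omega
  have hall : ∀ j : Fin k, st ∅ (t₀ + 1) Φ (Φ i j).1 ≠ none := by rw [← ht₀]; exact ht₁spec
  have hnot : ¬ ∀ j : Fin k, st ∅ t₀ Φ (Φ i j).1 ≠ none := by
    have := Nat.find_min hPR (show t₀ < Nat.find hPR by rw [← ht₁]; omega)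
    exact this
  obtain ⟨j, hj⟩ : ∃ j : Fin k, st ∅ t₀ Φ (Φ i j).1 = none := by
    by_contra h
    exact hnot fun j hj => h ⟨j, hj⟩
  set v : Fin n := (Φ i j).1 with hv
  by_cases hcase : ∃ j' : Fin k, j' ≠ j ∧ st ∅ t₀ Φ (Φ i j').1 = none
  · obtain ⟨j', hj'j, hj'⟩ := hcase
    by_cases hsame : (Φ i j').1 = v
    · -- (C) degenerate
      exact Or.inr (Or.inr ⟨j, j', hj'j.symm, hsame.symm⟩)
    · -- (B) collision at round `t₀`
      exact Or.inr (Or.inl ⟨t₀, ht₀R, j, j', fun h => hsame h.symm, hj, hj', hall j, hall j'⟩)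
  · -- (A) exactly the slot `j` was unset: `i` is unit on `v` at round `t₀`
    have hrest : ∀ j' : Fin k, j' ≠ j →
        st ∅ t₀ Φ (Φ i j').1 ≠ none ∧ st ∅ t₀ Φ (Φ i j').1 ≠ some (Φ i j').2 := by
      intro j' hj'j
      have hset : st ∅ t₀ Φ (Φ i j').1 ≠ none := fun h => hcase ⟨j', hj'j, h⟩
      refine ⟨hset, fun h => hviol j' ?_⟩
      exact sissU_st_mono st dm hstep ∅ Φ _ _ t₀ R ht₀R.le h
    have hvt : st ∅ t₀ Φ v = none := by rw [hv]; exact hj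
    have hunit : ∃ j₂ : Fin k, (Φ i j₂).1 = v ∧ st ∅ t₀ Φ v = none ∧ ∀ j' : Fin k, j' ≠ j₂ →
        st ∅ t₀ Φ (Φ i j').1 ≠ none ∧ st ∅ t₀ Φ (Φ i j').1 ≠ some (Φ i j').2 := ⟨j, rfl, hvt, hrest⟩
    -- the least unit clause `i₀` on `v`
    have hTne : (univ.filter fun i' : Fin m => i' ∉ (∅ : Finset (Fin m)) ∧ ∃ j₂ : Fin k, (Φ i' j₂).1 = v ∧
        ∀ j' : Fin k, j' ≠ j₂ → st ∅ t₀ Φ (Φ i' j').1 ≠ none ∧ st ∅ t₀ Φ (Φ i' j').1 ≠ some (Φ i' j').2).Nonempty :=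
      ⟨i, by simp only [mem_filter, mem_univ, true_and]; exact ⟨(by simp), j, rfl, hrest⟩⟩
    obtain ⟨i₀, hi₀mem, hi₀le⟩ : ∃ i₀ : Fin m, (i₀ ∈ univ.filter fun i' : Fin m => i' ∉ (∅ : Finset (Fin m)) ∧
        ∃ j₂ : Fin k, (Φ i' j₂).1 = v ∧ ∀ j' : Fin k, j' ≠ j₂ → st ∅ t₀ Φ (Φ i' j').1 ≠ none ∧
          st ∅ t₀ Φ (Φ i' j').1 ≠ some (Φ i' j').2) ∧
        ∀ i' ∈ (univ.filter fun i' : Fin m => i' ∉ (∅ : Finset (Fin m)) ∧ ∃ j₂ : Fin k, (Φ i' j₂).1 = v ∧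
          ∀ j' : Fin k, j' ≠ j₂ → st ∅ t₀ Φ (Φ i' j').1 ≠ none ∧ st ∅ t₀ Φ (Φ i' j').1 ≠ some (Φ i' j').2),
          i₀ ≤ i' :=
      ⟨_, min'_mem _ hTne, fun i' hi' => min'_le _ i' hi'⟩
    simp only [mem_filter, mem_univ, true_and] at hi₀mem hi₀le
    obtain ⟨hi₀S, j₀, hj₀, hrest₀⟩ := hi₀mem
    have hleast : ∀ i' : Fin m, i' ∉ (∅ : Finset (Fin m)) → (∃ j₁ : Fin k, (Φ i' j₁).1 = v ∧
        ∀ j' : Fin k, j' ≠ j₁ → st ∅ t₀ Φ (Φ i' j').1 ≠ none ∧ st ∅ t₀ Φ (Φ i' j').1 ≠ some (Φ i' j').2) →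
        i₀ ≤ i' := fun i' hi'S hi' => hi₀le i' ⟨hi'S, hi'⟩
    have hd : dm ∅ t₀ Φ v = (Φ i₀ j₀).2 := hdm ∅ t₀ Φ v i₀ j₀ hi₀S hj₀ hvt hrest₀ hleast
    have hforced : st ∅ (t₀ + 1) Φ v = some (dm ∅ t₀ Φ v) :=
      sissU_st_forced st dm hstep ∅ t₀ Φ v hvt ⟨i, (by simp), j, rfl, hrest⟩
    -- the forcing clause is not `i` itself (else `v` would satisfy `i`)
    have hi₀i : i₀ ≠ i := by
      intro h
      subst h
      have hj₀j : j₀ = j := sissU_unit_slot_unique st ∅ t₀ Φ i₀ v j hvt hrest j₀ hj₀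
      rw [hd, hj₀j] at hforced
      exact hviol j (sissU_st_mono st dm hstep ∅ Φ _ _ (t₀ + 1) R (by omega) hforced)
    exact Or.inl ⟨t₀, ht₀R, v, i₀, hi₀i, hunit, j₀, hj₀, hvt, hrest₀⟩

end Classify

end Summit.PneNP.PneNP.Theorems
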